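import Literature.NumberTheory.GaloisRepresentations.LubinTateColemanRelativeTildeTwo
import Literature.NumberTheory.GaloisRepresentations.LubinTateColemanRelativeCongruenceTwo
import Literature.NumberTheory.GaloisRepresentations.LubinTateColemanTwistedLift
import HarnessLib

/-!
# `q = 2`: de Shalit's I §3.10 over `𝒪_E`, twisted — for a Frobenius lift `ψ` every unit `g ∈ 𝒪_E⟦X⟧ˣ` is congruent
# modulo `π` to a unique `G` with `𝒩_E G = G^ψ`

De Shalit, *Iwasawa theory of elliptic curves with complex multiplication* (1987), Ch. I §3.10 Lemma (relative case,
`𝒩g = g^φ`), proved by the convergence `g = lim φ^{-i}𝒩^{(i)}g₀` of I §2.2 (2)–(3).  Instantiating the abstract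
twisted lift (`LubinTateColemanTwistedLift`: any `(p)`-adically complete `S`, any contracting multiplicative `𝒩`)
with `S = 𝒪_E` (`(π)`-adically complete: `LubinTateColemanRelativeTildeTwo`), `𝒩 = 𝒩_E = relNormTwoHom` and the
congruences (i) `𝒩_E h ≡ h^ψ (mod π)` (for `ψ(c) ≡ c² mod π`), (iv) of `LubinTateColemanRelativeCongruenceTwo`:

* ★★★ `exists_relNormTwo_eq_map_sub_mem` — for `ψ : 𝒪_E ≃+* 𝒪_E` with `ψ(π) = π`, `ψ(c) ≡ c² (mod π)` and every unit
  `g`: **there is `G` with `𝒩_E G = G^ψ` and `G ≡ g (mod π)`**;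
* ★★ `eq_of_relNormTwo_eq_map_of_sub_mem` — **uniqueness** among units.

With `E = k'` unramified over `F` and `ψ` its Frobenius this is the power-series half of Coleman's theorem for the
tower `k'·K_π^{n+1}` (`𝒰 ≅ {g : 𝒩_E g = g^φ}`); the interpolation `β_n = (φ^{-(n+1)}g)(ω_{n+1})` (field theory of the
composita) is the remaining step.  0 sorry, no named facts.

## References

* E. de Shalit, *Iwasawa theory of elliptic curves with complex multiplication* (1987), Ch. I §2.2, §3.10 Lemma.
  [deShalit1987]
-/

noncomputable section

open scoped PowerSeries.WithPiTopology

namespace Literature.NumberTheory.GaloisRepresentations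

section LocalFieldRel2g

open GaloisRepresentations.IsNonarchimedeanLocalField LubinTate ValuativeRel

variable (F : Type*) [Field F] [ValuativeRel F] [TopologicalSpace F] [IsNonarchimedeanLocalField F]

attribute [local instance] ltNormUniformSpace ltNormIsUniformAddGroup rk1 nF nE fintypeResidueField

variable {F}
variable {π : 𝒪[F]} (hπ : (valuation F).IsUniformizer (π : F))
variable (E : IntermediateField F (AlgebraicClosure F)) [FiniteDimensional F E]

/-! ### De Shalit's I §3.10 over `𝒪_E`, twisted by a Frobenius lift `ψ`: `𝒩_E G = G^ψ`, `G ≡ g (mod π)` -/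

/-- ★★★ **The twisted `𝒩_E`-invariant lift over `𝒪_E`** (`q = 2`; `ψ : 𝒪_E ≃+* 𝒪_E` with `ψ(π) = π` and
`ψ(c) ≡ c² (mod π)`, e.g. the Frobenius automorphism of an unramified `E/F`): for every unit `g ∈ 𝒪_E⟦X⟧ˣ` there is
`G` with **`𝒩_E G = G^ψ`** and `G ≡ g (mod π)` — Coleman's `ℳ = {𝒩_E G = G^ψ} → (𝒪_E/π)⟦X⟧ˣ` is onto
(I §3.10 Lemma in the relative case; the convergence `G = lim ψ^{-i}𝒩_E^{i} g` of I §2.2 (2)–(3)).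
[cite: deShalit1987, Ch. I §3.10 Lemma] -/
theorem exists_relNormTwo_eq_map_sub_mem (hq : residueFieldCard F = 2) (ψ : unitBall E ≃+* unitBall E)
    (hψ : ψ (algebraMap 𝒪[F] (unitBall E) π) = algebraMap 𝒪[F] (unitBall E) π)
    (hψ2 : ∀ c : unitBall E, ψ c - c ^ 2 ∈ Ideal.span {algebraMap 𝒪[F] (unitBall E) π})
    (g : (PowerSeries (unitBall E))ˣ) :
    ∃ G : PowerSeries (unitBall E), relNormTwo hπ E hq G = PowerSeries.map (ψ : unitBall E →+* unitBall E) G ∧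
      G - g ∈ coeffIdeal (Ideal.span {algebraMap 𝒪[F] (unitBall E) π}) := by
  haveI := isAdicComplete_span_algebraMap_pi hπ E
  have hNi : ∀ h : PowerSeries (unitBall E), relNormTwoHom hπ E hq h - PowerSeries.map (ψ : unitBall E →+* unitBall E) h ∈
      coeffIdeal (Ideal.span {algebraMap 𝒪[F] (unitBall E) π}) := fun h =>
    relNormTwo_sub_map_mem hπ E hq (ψ := (ψ : unitBall E →+* unitBall E)) hψ2 h
  have hNiv : ∀ (i : ℕ), 1 ≤ i → ∀ h : PowerSeries (unitBall E),
      h - 1 ∈ coeffIdeal (Ideal.span {algebraMap 𝒪[F] (unitBall E) π ^ i}) →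
      relNormTwoHom hπ E hq h - 1 ∈ coeffIdeal (Ideal.span {algebraMap 𝒪[F] (unitBall E) π ^ (i + 1)}) :=
    fun i hi h hh => relNormTwo_sub_one_mem hπ E hq hi hh
  obtain ⟨G, hG, hGi⟩ := exists_twistOp_eq_sub_mem (N := relNormTwoHom hπ E hq) (ψ := ψ) hψ hNi hNiv g
  refine ⟨G, hG, ?_⟩
  have h0 := hGi 0
  rwa [Function.iterate_zero, id, zero_add, pow_one] at h0

/-- ★★ **… and the lift is unique**: two units `G, G'` with `𝒩_E G = G^ψ`, `𝒩_E G' = G'^ψ`, `G ≡ G' (mod π)` are equal.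
[cite: deShalit1987, Ch. I §3.10 Lemma] -/
theorem eq_of_relNormTwo_eq_map_of_sub_mem (hq : residueFieldCard F = 2) (ψ : unitBall E ≃+* unitBall E)
    (hψ : ψ (algebraMap 𝒪[F] (unitBall E) π) = algebraMap 𝒪[F] (unitBall E) π) {G G' : PowerSeries (unitBall E)}
    (hG' : IsUnit G') (hN : relNormTwo hπ E hq G = PowerSeries.map (ψ : unitBall E →+* unitBall E) G)
    (hN' : relNormTwo hπ E hq G' = PowerSeries.map (ψ : unitBall E →+* unitBall E) G')
    (h : G - G' ∈ coeffIdeal (Ideal.span {algebraMap 𝒪[F] (unitBall E) π})) : G = G' := by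
  haveI := (isAdicComplete_span_algebraMap_pi hπ E).toIsHausdorff
  have hNiv : ∀ (i : ℕ), 1 ≤ i → ∀ h : PowerSeries (unitBall E),
      h - 1 ∈ coeffIdeal (Ideal.span {algebraMap 𝒪[F] (unitBall E) π ^ i}) →
      relNormTwoHom hπ E hq h - 1 ∈ coeffIdeal (Ideal.span {algebraMap 𝒪[F] (unitBall E) π ^ (i + 1)}) :=
    fun i hi h hh => relNormTwo_sub_one_mem hπ E hq hi hh
  exact eq_of_twistOp_eq_of_sub_mem (N := relNormTwoHom hπ E hq) (ψ := ψ) hψ hNiv hG' hN hN' h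

end LocalFieldRel2g

end Literature.NumberTheory.GaloisRepresentations
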